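import Summits.QuantumFields.YangMills.Theorems.ToronSmallBallOwnAxisShiftDefs
import Summits.QuantumFields.YangMills.Theorems.QuantileBitPuritySU2ClassShiftAxisLipschitz
import Literature.MathematicalPhysics.QuantumLattice.SU2HaarSmallBallUpper
import Mathlib.Analysis.SpecialFunctions.Trigonometric.Bounds
import HarnessLib

/-!
# The own-axis sheet shift: the local `SU(2)` estimate behind its second-order cost

Support module (`--supports` stmt-QuantumFields-24089, `ToronSmallBall.PeriodicOffCoreStripWindowDeep`; seat ym-dw-p1 g15).  The own-axis sheet
shift multiplies the plane link of the `x`-line through `x` by `h_x = exp(ι θ·axis P_x)`.  A plane plaquette `U_p` between the lines through `x` and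
`x + e_j` becomes (in the trace) `h_x · A h_{x+e_j}⁻¹ A⁻¹ · U_p` with `A h_{x+e_j} A⁻¹ = h_{A P_{x+e_j} A⁻¹}` (the own-axis rotation of the
TRANSPORTED neighbouring holonomy), and a time-like plane link coupling `U V⁻¹` becomes `h'⁻¹ h · U V⁻¹`.  Both are `Re tr (E · M)` with
`E = e_P e_Q⁻¹` (or `e_Q⁻¹ e_P`) a quotient of two rotations BY THE SAME ANGLE about two nearby axes, and we prove (quaternion model of `SU(2)`):

* §1 `re_mul_ge_of_norm_one`: for unit quaternions `E`, `m`: `re(E m) ≥ re m − ‖E − 1‖²/2 − ‖E − 1‖·‖m − 1‖` — the change is SECOND ORDER: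
  quadratic in the axis defect plus (axis defect) × (distance of `m` to `1`);
* §2 `‖e_P − e_Q‖ = |sin θ|·‖axis P − axis Q‖ ≤ |θ|·(2‖q_P − q_Q‖/‖Im q_P‖)` (tree `ClassShift.norm_axisVec_sub_le`), with `e_W = q(exp(ι θ·axis W))`;
* §3 ★ `re_trace_rot_mul_rot_inv_mul_ge` / `re_trace_rot_inv_mul_rot_mul_ge`: for non-central `P, Q ∈ SU(2)` and every `M ∈ SU(2)`,
  `Re tr(h_P h_Q⁻¹ M) ≥ Re tr M − θ² D² − 2|θ| D ‖q_M − 1‖` and the same for `h_Q⁻¹ h_P M`, where `D = ‖axis P − axis Q‖ ≤ 2‖q_P − q_Q‖/‖Im q_P‖`;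
  the dictionary `‖q_M − 1‖² = 2 − Re tr M` (plaquette deficit) and `‖q_U − q_V‖ ≤ ‖U − V‖_F` (time closeness).

HONEST FRAMING: elementary inequalities on one compact group; nothing about infinite volume, the continuum limit or the Clay gap.  No `sorry`, no new
axiom, no new definition.  References: [folklore]; [cite: Luscher1983, §2] (where the cost bookkeeping is used).
-/

set_option autoImplicit false

noncomputable section

open scoped Quaternion
open NormedSpace
open Literature.MathematicalPhysics.QuantumLattice (su2Quat su2Quat_ne_zero norm_su2Quat quatMatrix_su2Quat trace_quatMatrix_re abs_re_le_norm)
open Literature.MathematicalPhysics.QuantumFieldTheory (frobNorm frobNorm_nonneg)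
open Literature.MathematicalPhysics.QuantumFieldTheory.Balaban1983to89.T4HaarSU2ExpChart
open Literature.MathematicalPhysics.QuantumFieldTheory.Balaban1983to89.T4HaarSU2Translate (su2Quat_mul su2Quat_one)

namespace Summit.QuantumFields.YangMills.Theorems.FemtoTransferGap.OwnAxis

open ClassShift

/-! ## §1 Quaternion algebra: the second-order expansion of `re(E m)` -/

/-- ★ **Second-order expansion**: for unit quaternions `E`, `m`, `re(E·m) ≥ re m − ‖E − 1‖²/2 − ‖E − 1‖·‖m − 1‖`. [folklore] -/
theorem re_mul_ge_of_norm_one {E m : ℍ} (hE : ‖E‖ = 1) :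
    m.re - ‖E - 1‖ ^ 2 / 2 - ‖E - 1‖ * ‖m - 1‖ ≤ (E * m).re := by
  have hdec : E * m = m + (E - 1) + (E - 1) * (m - 1) := by noncomm_ring
  have hre : (E * m).re = m.re + (E.re - 1) + ((E - 1) * (m - 1)).re := by
    rw [hdec]; simp [Quaternion.re_sub]
  -- `‖E − 1‖² = 2 − 2 re E` for the unit quaternion `E` (tree: `T4ExpWindowSmallField.norm_sub_one_sq`; three lines keep that import out)
  have hsq : ‖E - 1‖ ^ 2 = 2 - 2 * E.re := by
    have h1 : ‖E‖ ^ 2 = E.re ^ 2 + E.imI ^ 2 + E.imJ ^ 2 + E.imK ^ 2 := by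
      rw [sq, ← Quaternion.normSq_eq_norm_mul_self, Quaternion.normSq_def']
    have h2 : ‖E - 1‖ ^ 2 = (E.re - 1) ^ 2 + E.imI ^ 2 + E.imJ ^ 2 + E.imK ^ 2 := by
      rw [sq, ← Quaternion.normSq_eq_norm_mul_self, Quaternion.normSq_def']
      simp
    rw [hE] at h1
    nlinarith
  have h1 : E.re - 1 = -(‖E - 1‖ ^ 2 / 2) := by rw [hsq]; ring
  have h2 : -(‖E - 1‖ * ‖m - 1‖) ≤ ((E - 1) * (m - 1)).re := by
    have := abs_re_le_norm ((E - 1) * (m - 1))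
    rw [norm_mul] at this
    exact (abs_le.1 this).1
  rw [hre, h1]
  linarith

/-- `‖E − 1‖ = ‖e − e'‖` for `E = e e'⁻¹`, `e'` a unit quaternion. [folklore] -/
theorem norm_mul_inv_sub_one {e e' : ℍ} (he' : ‖e'‖ = 1) : ‖e * e'⁻¹ - 1‖ = ‖e - e'‖ := by
  have hne : e' ≠ 0 := fun h => by rw [h, norm_zero] at he'; exact zero_ne_one he'
  have : e * e'⁻¹ - 1 = (e - e') * e'⁻¹ := by rw [sub_mul, mul_inv_cancel₀ hne]
  rw [this, norm_mul, norm_inv, he', inv_one, mul_one]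

/-- `‖E − 1‖ = ‖e − e'‖` for `E = e'⁻¹ e`, `e'` a unit quaternion. [folklore] -/
theorem norm_inv_mul_sub_one {e e' : ℍ} (he' : ‖e'‖ = 1) : ‖e'⁻¹ * e - 1‖ = ‖e - e'‖ := by
  have hne : e' ≠ 0 := fun h => by rw [h, norm_zero] at he'; exact zero_ne_one he'
  have : e'⁻¹ * e - 1 = e'⁻¹ * (e - e') := by rw [mul_sub, inv_mul_cancel₀ hne]
  rw [this, norm_mul, norm_inv, he', inv_one, one_mul]

/-! ## §2 Rotations by the same angle about two axes -/

/-- The rotation `cos θ + sin θ·ι a` about a unit axis `a` is a unit quaternion. [folklore] -/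
theorem norm_rot_eq_one (θ : ℝ) {a : EuclideanSpace ℝ (Fin 3)} (ha : ‖a‖ = 1) : ‖(Real.cos θ : ℍ) + Real.sin θ • imQuat a‖ = 1 := by
  rw [← exp_imQuat_smul ha, norm_exp_imQuat]

/-- ★ **Two rotations by the same angle differ by `|sin θ| × (axis difference)`**: `‖(cos θ + sin θ ιa) − (cos θ + sin θ ιa')‖ = |sin θ|·‖a − a'‖`.
[folklore] -/
theorem norm_rot_sub_rot (θ : ℝ) (a a' : EuclideanSpace ℝ (Fin 3)) :
    ‖((Real.cos θ : ℍ) + Real.sin θ • imQuat a) - ((Real.cos θ : ℍ) + Real.sin θ • imQuat a')‖ = |Real.sin θ| * ‖a - a'‖ := by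
  have : ((Real.cos θ : ℍ) + Real.sin θ • imQuat a) - ((Real.cos θ : ℍ) + Real.sin θ • imQuat a') = Real.sin θ • imQuat (a - a') := by
    rw [map_sub, smul_sub]; abel
  rw [this, norm_smul, Real.norm_eq_abs, norm_imQuat]

/-- The axis of a non-central element is a unit vector. [folklore] -/
theorem norm_axisVec_eq_one {W : Matrix.specialUnitaryGroup (Fin 2) ℂ} (hW : imVec (su2Quat W) ≠ 0) : ‖axisVec W‖ = 1 := by
  unfold axisVec
  rw [norm_smul, norm_inv, norm_norm, inv_mul_cancel₀ (norm_ne_zero_iff.2 hW)]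

/-- The quaternion of the own-axis rotation `exp(ι θ·axis W)` of a non-central `W`: `cos θ + sin θ·ι(axis W)`. [folklore] -/
theorem su2Quat_expPoint_axisVec (θ : ℝ) {W : Matrix.specialUnitaryGroup (Fin 2) ℂ} (hW : imVec (su2Quat W) ≠ 0) :
    su2Quat (expPoint (θ • axisVec W)) = (Real.cos θ : ℍ) + Real.sin θ • imQuat (axisVec W) := by
  rw [su2Quat_expPoint, exp_imQuat_smul (norm_axisVec_eq_one hW)]

/-- **Axis defect**: `‖e_P − e_Q‖ ≤ |θ| · (2‖q_P − q_Q‖/‖Im q_P‖)` for the own-axis rotations of two non-central elements. [folklore] -/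
theorem norm_su2Quat_rot_sub_rot_le (θ : ℝ) {P Q : Matrix.specialUnitaryGroup (Fin 2) ℂ} (hP : imVec (su2Quat P) ≠ 0) (hQ : imVec (su2Quat Q) ≠ 0) :
    ‖su2Quat (expPoint (θ • axisVec P)) - su2Quat (expPoint (θ • axisVec Q))‖ ≤ |θ| * (2 * ‖su2Quat P - su2Quat Q‖ / ‖imVec (su2Quat P)‖) := by
  rw [su2Quat_expPoint_axisVec θ hP, su2Quat_expPoint_axisVec θ hQ, norm_rot_sub_rot]
  exact mul_le_mul Real.abs_sin_le_abs (norm_axisVec_sub_le hP Q) (norm_nonneg _) (abs_nonneg _)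

/-! ## §3 The `SU(2)` dictionary and the two trace estimates -/

/-- `‖q_M − 1‖ = √(2 − Re tr M)`. [folklore] -/
theorem norm_su2Quat_sub_one_eq_sqrt (M : Matrix.specialUnitaryGroup (Fin 2) ℂ) :
    ‖su2Quat M - 1‖ = Real.sqrt (2 - ((M : Matrix (Fin 2) (Fin 2) ℂ).trace).re) := by
  -- `‖q_M − 1‖² = 2 − Re tr M` (tree: `NE7b.CompactFibreWindowSU2.norm_su2Quat_sub_one_sq`, re-derived to keep imports inside `Theorems/`)
  have hre : ((M : Matrix (Fin 2) (Fin 2) ℂ).trace).re = 2 * (su2Quat M).re := by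
    rw [← quatMatrix_su2Quat M]; exact trace_quatMatrix_re _
  have hq : ‖su2Quat M - 1‖ ^ 2 = 2 - 2 * (su2Quat M).re := by
    have h1 : ‖su2Quat M‖ ^ 2 = (su2Quat M).re ^ 2 + (su2Quat M).imI ^ 2 + (su2Quat M).imJ ^ 2 + (su2Quat M).imK ^ 2 := by
      rw [sq, ← Quaternion.normSq_eq_norm_mul_self, Quaternion.normSq_def']
    have h3 : ‖su2Quat M - 1‖ ^ 2 = ((su2Quat M).re - 1) ^ 2 + (su2Quat M).imI ^ 2 + (su2Quat M).imJ ^ 2 + (su2Quat M).imK ^ 2 := by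
      rw [sq, ← Quaternion.normSq_eq_norm_mul_self, Quaternion.normSq_def']
      simp
    rw [norm_su2Quat] at h1
    nlinarith
  rw [← Real.sqrt_sq (norm_nonneg (su2Quat M - 1)), hq, hre]

/-- `‖q_M − 1‖² = 2 − Re tr M`: the quaternion distance of `M` to `1`, squared, is its plaquette deficit. [folklore] -/
theorem two_sub_re_trace_eq_norm_sq (M : Matrix.specialUnitaryGroup (Fin 2) ℂ) :
    2 - ((M : Matrix (Fin 2) (Fin 2) ℂ).trace).re = ‖su2Quat M - 1‖ ^ 2 := by
  have h0 : 0 ≤ 2 - ((M : Matrix (Fin 2) (Fin 2) ℂ).trace).re := by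
    rw [two_sub_re_trace_eq]; positivity
  rw [norm_su2Quat_sub_one_eq_sqrt, Real.sq_sqrt h0]

/-- **Closeness dictionary**: `‖q_U − q_V‖ = ‖q_{UV⁻¹} − 1‖`. [folklore] -/
theorem norm_su2Quat_sub_eq (U V : Matrix.specialUnitaryGroup (Fin 2) ℂ) : ‖su2Quat U - su2Quat V‖ = ‖su2Quat (U * V⁻¹) - 1‖ := by
  rw [su2Quat_mul, su2Quat_inv, norm_mul_inv_sub_one (norm_su2Quat V)]

/-- `‖q_U − q_V‖² = ‖U − V‖_F² / 2`. [folklore] -/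
theorem norm_su2Quat_sub_sq_eq (U V : Matrix.specialUnitaryGroup (Fin 2) ℂ) :
    ‖su2Quat U - su2Quat V‖ ^ 2 = frobNorm ((U : Matrix (Fin 2) (Fin 2) ℂ) - (V : Matrix (Fin 2) (Fin 2) ℂ)) ^ 2 / 2 := by
  rw [norm_su2Quat_sub_eq, ← two_sub_re_trace_eq_norm_sq, frobNorm_sub_eq_mul_inv, two_sub_re_trace_eq]

/-- ★ `‖q_U − q_V‖ ≤ ‖U − V‖_F` (the quaternion distance is `1/√2` of the Frobenius one). [folklore] -/
theorem norm_su2Quat_sub_le_frobNorm (U V : Matrix.specialUnitaryGroup (Fin 2) ℂ) :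
    ‖su2Quat U - su2Quat V‖ ≤ frobNorm ((U : Matrix (Fin 2) (Fin 2) ℂ) - (V : Matrix (Fin 2) (Fin 2) ℂ)) := by
  have h := norm_su2Quat_sub_sq_eq U V
  have hF := frobNorm_nonneg ((U : Matrix (Fin 2) (Fin 2) ℂ) - (V : Matrix (Fin 2) (Fin 2) ℂ))
  nlinarith [norm_nonneg (su2Quat U - su2Quat V)]

/-- **Abstract trace estimate**: if `‖q_E − 1‖ ≤ δ` then `Re tr(E M) ≥ Re tr M − δ² − 2δ‖q_M − 1‖`. [folklore] -/
theorem re_trace_mul_ge_of_norm_sub_one_le {E : Matrix.specialUnitaryGroup (Fin 2) ℂ} {δ : ℝ} (hE : ‖su2Quat E - 1‖ ≤ δ)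
    (M : Matrix.specialUnitaryGroup (Fin 2) ℂ) :
    ((M : Matrix (Fin 2) (Fin 2) ℂ).trace).re - δ ^ 2 - 2 * δ * ‖su2Quat M - 1‖ ≤ (((E * M : Matrix.specialUnitaryGroup (Fin 2) ℂ) : Matrix (Fin 2) (Fin 2) ℂ).trace).re := by
  have hδ : 0 ≤ δ := (norm_nonneg _).trans hE
  have hre : ∀ W : Matrix.specialUnitaryGroup (Fin 2) ℂ, ((W : Matrix (Fin 2) (Fin 2) ℂ).trace).re = 2 * (su2Quat W).re := fun W => by
    rw [← quatMatrix_su2Quat W]; exact trace_quatMatrix_re _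
  rw [hre, hre, su2Quat_mul]
  have h := re_mul_ge_of_norm_one (m := su2Quat M) (norm_su2Quat E)
  have h1 : ‖su2Quat E - 1‖ ^ 2 ≤ δ ^ 2 := pow_le_pow_left₀ (norm_nonneg _) hE 2
  have h2 : ‖su2Quat E - 1‖ * ‖su2Quat M - 1‖ ≤ δ * ‖su2Quat M - 1‖ := mul_le_mul_of_nonneg_right hE (norm_nonneg _)
  linarith

/-- ★ **Plaquette form**: for non-central `P, Q` and every `M`,
`Re tr(exp(ιθ axis P) · exp(ιθ axis Q)⁻¹ · M) ≥ Re tr M − (θD)² − 2|θ|D‖q_M − 1‖`, `D = 2‖q_P − q_Q‖/‖Im q_P‖`. [cite: Luscher1983, §2] -/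
theorem re_trace_rot_mul_rot_inv_mul_ge (θ : ℝ) {P Q : Matrix.specialUnitaryGroup (Fin 2) ℂ} (hP : imVec (su2Quat P) ≠ 0) (hQ : imVec (su2Quat Q) ≠ 0)
    (M : Matrix.specialUnitaryGroup (Fin 2) ℂ) :
    ((M : Matrix (Fin 2) (Fin 2) ℂ).trace).re - (|θ| * (2 * ‖su2Quat P - su2Quat Q‖ / ‖imVec (su2Quat P)‖)) ^ 2
        - 2 * (|θ| * (2 * ‖su2Quat P - su2Quat Q‖ / ‖imVec (su2Quat P)‖)) * ‖su2Quat M - 1‖ ≤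
      (((expPoint (θ • axisVec P) * (expPoint (θ • axisVec Q))⁻¹ * M : Matrix.specialUnitaryGroup (Fin 2) ℂ) : Matrix (Fin 2) (Fin 2) ℂ).trace).re := by
  refine re_trace_mul_ge_of_norm_sub_one_le ?_ M
  rw [su2Quat_mul, su2Quat_inv, norm_mul_inv_sub_one (norm_su2Quat _)]
  exact norm_su2Quat_rot_sub_rot_le θ hP hQ

/-- ★ **Time-link form**: for non-central `P, Q` and every `M`,
`Re tr(exp(ιθ axis Q)⁻¹ · exp(ιθ axis P) · M) ≥ Re tr M − (θD)² − 2|θ|D‖q_M − 1‖`, `D = 2‖q_P − q_Q‖/‖Im q_P‖`. [cite: Luscher1983, §2] -/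
theorem re_trace_rot_inv_mul_rot_mul_ge (θ : ℝ) {P Q : Matrix.specialUnitaryGroup (Fin 2) ℂ} (hP : imVec (su2Quat P) ≠ 0) (hQ : imVec (su2Quat Q) ≠ 0)
    (M : Matrix.specialUnitaryGroup (Fin 2) ℂ) :
    ((M : Matrix (Fin 2) (Fin 2) ℂ).trace).re - (|θ| * (2 * ‖su2Quat P - su2Quat Q‖ / ‖imVec (su2Quat P)‖)) ^ 2
        - 2 * (|θ| * (2 * ‖su2Quat P - su2Quat Q‖ / ‖imVec (su2Quat P)‖)) * ‖su2Quat M - 1‖ ≤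
      ((((expPoint (θ • axisVec Q))⁻¹ * expPoint (θ • axisVec P) * M : Matrix.specialUnitaryGroup (Fin 2) ℂ) : Matrix (Fin 2) (Fin 2) ℂ).trace).re := by
  refine re_trace_mul_ge_of_norm_sub_one_le ?_ M
  rw [su2Quat_mul, su2Quat_inv, norm_inv_mul_sub_one (norm_su2Quat _)]
  exact norm_su2Quat_rot_sub_rot_le θ hP hQ

/-- **Conjugation keeps non-centrality**: `‖Im q(g W g⁻¹)‖ = ‖Im q_W‖`. [folklore] -/
theorem norm_imVec_su2Quat_conj (g W : Matrix.specialUnitaryGroup (Fin 2) ℂ) :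
    ‖imVec (su2Quat (g * W * g⁻¹))‖ = ‖imVec (su2Quat W)‖ := by
  rw [norm_imVec, norm_imVec, su2Quat_mul, su2Quat_mul, su2Quat_inv, im_conj_quat (su2Quat_ne_zero g), norm_conj_quat (norm_su2Quat g)]

/-- **Non-centrality is stable**: `|‖Im q_P‖ − ‖Im q_Q‖| ≤ ‖q_P − q_Q‖`. [folklore] -/
theorem abs_norm_imVec_sub_le (P Q : Matrix.specialUnitaryGroup (Fin 2) ℂ) :
    |‖imVec (su2Quat P)‖ - ‖imVec (su2Quat Q)‖| ≤ ‖su2Quat P - su2Quat Q‖ := by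
  rw [norm_imVec, norm_imVec]
  refine (abs_norm_sub_norm_le _ _).trans ?_
  rw [← Quaternion.im_sub]
  have h := norm_imVec_le (su2Quat P - su2Quat Q)
  rwa [norm_imVec] at h

end Summit.QuantumFields.YangMills.Theorems.FemtoTransferGap.OwnAxis

end
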